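import Literature.Geometry.ComplexAnalytic.PhamBrieskornFibreSymmetries
import Literature.Analysis.Complex.OsgoodProofs
import Literature.Geometry.Manifold.InverseFunctionTheorem
import Mathlib.Analysis.SpecialFunctions.Pow.Deriv
import HarnessLib

/-!
# Explicit Morse coordinates for the cyclic-node pencil `x₃^p = x₀x₁ + x₀^p + x₁^p + c` :
# a holomorphic chart `Θ` at the singular point with `(z₀² + z₁² + z₂^p) ∘ Θ = x₃^p − (x₀x₁ + x₀^p + x₁^p)`

Layer `Literature/Geometry/ComplexAnalytic`; theorems only (no definition, no named fact). Written by the prover seat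
`hodge-nonav-prover-Ax` (g10) for the programme "localisation of the nodal meridian monodromy" (crux K1 of the route
`Summits/HodgeConjecture/HodgeConjecture/Theses/CyclicUnitaryPowers.lean`).

The one-nodal branch curve used by the route is `f₁ = x₂^{p−2}x₀x₁ + x₀^p + x₁^p` (node `[0:0:1]`;
`Summits/…/CyclicUnitaryPowersUninodalTernaryForm`), and the pencil of `p`-cyclic covers through it in the direction
`x₂^p` is `x₃^p = f₁ + c·x₂^p`. In the affine chart `x₂ = 1` of `ℙ³`, with coordinates `x = (x₀, x₁, x₃)`, the member
`c` is the level set `φ = c` of the POLYNOMIAL `φ(x) = x₃^p − (x₀x₁ + x₀^p + x₁^p)`, which has an isolated critical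
point at `0` (the `A_{p−1}` surface singularity `y^p = uv` of Carlson–Toledo §6 (kdoublept)). The holomorphic Morse lemma
puts `φ` in the Brieskorn–Pham normal form `z₀² + z₁² + z₂^p` of the tree's model (`cyclicNodeExponents p = (2, 2, p)`,
files `PhamBrieskornCyclicNode*`). For THIS `φ` the Morse coordinates are EXPLICIT — no general Morse lemma is needed:
with `A = x₀^{p−2}`, `2B = 1`, `C = x₁^{p−2}` (`x₀x₁ + x₀^p + x₁^p = Ax₀² + 2Bx₀x₁ + Cx₁²`), the root
`k = B + √(B² − AC) = ½ + (¼ − (x₀x₁)^{p−2})^{1/2}` of `k² − 2Bk + AC = 0` (holomorphic on `‖x₀x₁‖ < ¼`, `k(0) = 1`)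
gives the factorisation

  `x₀x₁ + x₀^p + x₁^p = k · u · v`,  `u = x₀ + x₁^{p−1}/k`,  `v = x₁ + x₀^{p−1}/k`,

and with `a = −k u`, `b = v`, `z₀ = (a + b)/2`, `z₁ = (a − b)/(2i)`, `z₂ = x₃` one has `z₀² + z₁² = ab = −kuv`, so
`z₀² + z₁² + z₂^p = φ`. The map `Θ : x ↦ (z₀, z₁, z₂)` fixes `0` and has the invertible differential
`h ↦ ((−h₀ + h₁)/2, (−h₀ − h₁)/(2i), h₂)` at `0`, hence is a biholomorphism near `0` (inverse function theorem):

* `exists_cyclicNodePencil_morseChart` — **a local diffeomorphism `Θ` of `ℂ³` at `0` (`0 ∈ source`, `Θ 0 = 0`,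
  complex-differentiable and real-`C^∞` on its source, real-`C^∞` inverse on its target) with
  `Σᵢ (Θ x)ᵢ^{eᵢ} = x₂^p − (x₀x₁ + x₀^p + x₁^p)` and `(Θ x)₂ = x₂` on the source** (so the covering transformation
  `x₃ ↦ ζx₃` reads `z₂ ↦ ζz₂`).

This is the chart in which the geometric monodromy of the pencil is the model rotation `(−z₀, −z₁, ζz₂)` on a ball
(`PhamBrieskornCyclicNodeSphereTransversal`, `PhamBrieskornJoinBounded`, `PhamBrieskornCyclicNodeLocalisationHomotopy`).

## References

* [Milnor1968] J. Milnor, Singular Points of Complex Hypersurfaces, §9 (Brieskorn–Pham polynomials), Lemma 9.4.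
* [ArnoldGuseinzadeVarchenko2012] V. I. Arnold, S. M. Gusein-Zade, A. N. Varchenko, Singularities of Differentiable Maps,
  Vol. 2, Part I §2.3 (quasi-homogeneous normal forms; `A_k`).
* [CarlsonToledo1999] J. A. Carlson, D. Toledo, Duke Math. J. 97 (1999), §6 (kdoublept) (held text p0013): the local
  equation `y^k = x₁² + x₂²` of the cyclic cover over a node.
* [Milnor1963] J. Milnor, Morse theory, Ann. of Math. Studies 51, Lemma 2.2 (the Morse lemma).
-/

noncomputable section

open Complex Set Filter Function
open scoped Topology ContDiff

namespace Literature.Geometry.ComplexAnalytic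

namespace PhamBrieskorn

section MorseChart

/-! ### The algebra of the explicit factorisation -/

/-- `((a + b)/2)² + ((a − b)/(2i))² = ab`. [folklore] -/
private theorem half_sum_sq_add_half_diff_sq (a b : ℂ) :
    ((a + b) / 2) ^ 2 + ((a - b) / (2 * I)) ^ 2 = a * b := by
  have hI : (2 * I) ^ 2 = -4 := by rw [mul_pow, Complex.I_sq]; norm_num
  rw [div_pow, div_pow, hI]
  ring

/-- The factorisation `x₀x₁ + x₀^p + x₁^p = k·u·v` (`p = m + 3`): if `k² = k − (x₀x₁)^{m+1}` and `k ≠ 0` then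
`k (x₀ + x₁^{m+2}/k)(x₁ + x₀^{m+2}/k) = x₀x₁ + x₀^{m+3} + x₁^{m+3}`. [folklore] -/
private theorem morse_factorisation (m : ℕ) {x₀ x₁ k : ℂ} (hk : k ≠ 0) (hk2 : k ^ 2 = k - (x₀ * x₁) ^ (m + 1)) :
    k * (x₀ + x₁ ^ (m + 2) / k) * (x₁ + x₀ ^ (m + 2) / k) = x₀ * x₁ + x₀ ^ (m + 3) + x₁ ^ (m + 3) := by
  have h1 : k * (x₀ + x₁ ^ (m + 2) / k) * (x₁ + x₀ ^ (m + 2) / k) =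
      (k ^ 2 * (x₀ * x₁) + k * x₀ ^ (m + 3) + k * x₁ ^ (m + 3) + (x₀ * x₁) ^ (m + 2)) / k := by
    field_simp
    ring
  rw [h1, hk2, div_eq_iff hk]
  ring

/-- `(1/4 : ℂ) ^ (1/2) = 1/2` for the principal branch. [folklore] -/
private theorem one_quarter_cpow_half : ((1 / 4 : ℂ)) ^ ((2 : ℂ)⁻¹) = 1 / 2 := by
  have h1 : (1 / 4 : ℂ) = ((((1 / 2 : ℝ)) ^ 2 : ℝ) : ℂ) := by push_cast; norm_num
  have h2 : ((2 : ℂ)⁻¹) = (((2 : ℕ) : ℝ)⁻¹ : ℝ) := by push_cast; norm_num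
  rw [h1, h2, ← Complex.ofReal_cpow (by positivity), Real.pow_rpow_inv_natCast (by norm_num) two_ne_zero]
  push_cast; norm_num

/-! ### The chart -/

/-- **Explicit Morse chart for the cyclic-node pencil.** For `p ≥ 3` there is a local diffeomorphism `Θ` of `ℂ³` at
the origin — an `OpenPartialHomeomorph` with `0 ∈ source`, `Θ 0 = 0`, complex-differentiable and real-`C^∞` on its
(open) source, with real-`C^∞` inverse on its target — such that on the source

  `(Θ x)₀² + (Θ x)₁² + (Θ x)₂^p = x₂^p − (x₀x₁ + x₀^p + x₁^p)`  and  `(Θ x)₂ = x₂`,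

i.e. `Σᵢ (Θ x)ᵢ^{eᵢ} = φ(x)` for the cyclic-node exponents `e = (2, 2, p)`: the pencil function `φ` of
`x₃^p = x₀x₁x₂^{p−2} + x₀^p + x₁^p + c x₂^p` in the chart `x₂ = 1` IS the Brieskorn–Pham polynomial `z₀² + z₁² + z₂^p`
in the holomorphic coordinates `z = Θ(x)`. Explicitly `Θ(x) = ((a+b)/2, (a−b)/(2i), x₂)` with `a = −k u`, `b = v`,
`k = ½ + (¼ − (x₀x₁)^{p−2})^{1/2}`, `u = x₀ + x₁^{p−1}/k`, `v = x₁ + x₀^{p−1}/k`.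
[cite: Milnor1968, §9 Lemma 9.4] [cite: ArnoldGuseinzadeVarchenko2012, Part I §2.3]
[cite: CarlsonToledo1999, §6 (kdoublept) (held text p0013)] [cite: Milnor1963, Lemma 2.2] -/
theorem exists_cyclicNodePencil_morseChart {p : ℕ} (hp : 3 ≤ p) :
    ∃ Θ : OpenPartialHomeomorph (Fin (1 + 2) → ℂ) (Fin (1 + 2) → ℂ),
      (0 : Fin (1 + 2) → ℂ) ∈ Θ.source ∧ Θ 0 = 0 ∧
      DifferentiableOn ℂ Θ Θ.source ∧ ContDiffOn ℝ ∞ Θ Θ.source ∧ ContDiffOn ℝ ∞ Θ.symm Θ.target ∧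
      (∀ x ∈ Θ.source, ∑ i, (Θ x) i ^ cyclicNodeExponents p i = x 2 ^ p - (x 0 * x 1 + x 0 ^ p + x 1 ^ p)) ∧
      (∀ x ∈ Θ.source, (Θ x) 2 = x 2) := by
  obtain ⟨m, rfl⟩ : ∃ m, p = m + 3 := ⟨p - 3, by omega⟩
  -- the ingredients, as functions of `x`
  let w : (Fin (1 + 2) → ℂ) → ℂ := fun x => 1 / 4 - (x 0 * x 1) ^ (m + 1)
  let s : (Fin (1 + 2) → ℂ) → ℂ := fun x => w x ^ ((2 : ℂ)⁻¹)
  let k : (Fin (1 + 2) → ℂ) → ℂ := fun x => 1 / 2 + s x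
  let u : (Fin (1 + 2) → ℂ) → ℂ := fun x => x 0 + x 1 ^ (m + 2) * (k x)⁻¹
  let v : (Fin (1 + 2) → ℂ) → ℂ := fun x => x 1 + x 0 ^ (m + 2) * (k x)⁻¹
  let a : (Fin (1 + 2) → ℂ) → ℂ := fun x => -(k x * u x)
  let θ₀ : (Fin (1 + 2) → ℂ) → ℂ := fun x => (a x + v x) / 2
  let θ₁ : (Fin (1 + 2) → ℂ) → ℂ := fun x => (a x - v x) / (2 * I)
  let θ : (Fin (1 + 2) → ℂ) → Fin (1 + 2) → ℂ := fun x => ![θ₀ x, θ₁ x, x 2]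
  have hθ_apply0 : ∀ x, θ x 0 = θ₀ x := fun x => rfl
  have hθ_apply1 : ∀ x, θ x 1 = θ₁ x := fun x => rfl
  have hθ_apply2 : ∀ x, θ x 2 = x 2 := fun x => rfl
  -- the domain `U = {‖x₀ x₁‖ < 1/4}`
  let U : Set (Fin (1 + 2) → ℂ) := {x | ‖x 0 * x 1‖ < 1 / 4}
  have hUo : IsOpen U := isOpen_lt (by fun_prop) continuous_const
  have h0U : (0 : Fin (1 + 2) → ℂ) ∈ U := by simp [U]
  -- on `U`: `w x` has positive real part (slit plane), `s² = w`, `k² = k − (x₀x₁)^{m+1}`, `k ≠ 0`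
  have hw_re : ∀ x ∈ U, 0 < (w x).re := by
    intro x hx
    have hx' : ‖x 0 * x 1‖ < 1 / 4 := hx
    have h1 : ‖(x 0 * x 1) ^ (m + 1)‖ < 1 / 4 := by
      rw [norm_pow]
      calc ‖x 0 * x 1‖ ^ (m + 1) ≤ ‖x 0 * x 1‖ ^ 1 :=
            pow_le_pow_of_le_one (norm_nonneg _) (by linarith) (by omega)
        _ < 1 / 4 := by rw [pow_one]; exact hx'
    have h2 : |((x 0 * x 1) ^ (m + 1)).re| < 1 / 4 := lt_of_le_of_lt (Complex.abs_re_le_norm _) h1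
    have h3 : (w x).re = 1 / 4 - ((x 0 * x 1) ^ (m + 1)).re := by
      simp only [w, Complex.sub_re]
      norm_num
    rw [h3]
    linarith [(abs_lt.1 h2).2]
  have hw_slit : ∀ x ∈ U, w x ∈ slitPlane := fun x hx => Or.inl (hw_re x hx)
  have hs_sq : ∀ x, s x ^ 2 = w x := fun x => Complex.cpow_nat_inv_pow (w x) two_ne_zero
  have hk2 : ∀ x, k x ^ 2 = k x - (x 0 * x 1) ^ (m + 1) := by
    intro x
    have h := hs_sq x
    simp only [k, w] at h ⊢
    linear_combination h
  have hw0 : w 0 = 1 / 4 := by simp [w]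
  have hs0 : s 0 = 1 / 2 := by
    show w 0 ^ ((2 : ℂ)⁻¹) = 1 / 2
    rw [hw0]
    exact one_quarter_cpow_half
  have hk0 : k 0 = 1 := by simp only [k, hs0]; norm_num
  have hk_ne : ∀ x ∈ U, k x ≠ 0 := by
    intro x hx hk
    -- `k = 0 ⇒ s = −1/2 ⇒ w = s² = 1/4 ⇒ (x₀x₁)^{m+1} = 0 ⇒ s = (1/4)^{1/2} = 1/2`, absurd
    have hs : s x = -(1 / 2) := by
      have : 1 / 2 + s x = 0 := hk
      linear_combination this
    have hw : w x = 1 / 4 := by rw [← hs_sq x, hs]; norm_num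
    have hs' : s x = 1 / 2 := by
      show w x ^ ((2 : ℂ)⁻¹) = 1 / 2
      rw [hw]
      exact one_quarter_cpow_half
    rw [hs'] at hs
    norm_num at hs
  -- complex differentiability on `U`
  have hw_d : Differentiable ℂ w := by simp only [w]; fun_prop
  have hs_d : DifferentiableOn ℂ s U := fun x hx =>
    ((hw_d x).cpow_const (hw_slit x hx)).differentiableWithinAt
  have hk_d : DifferentiableOn ℂ k U := (differentiableOn_const _).add hs_d
  have hX : ∀ i : Fin (1 + 2), DifferentiableOn ℂ (fun x : Fin (1 + 2) → ℂ => x i) U := fun i =>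
    (differentiable_apply (𝕜 := ℂ) i).differentiableOn
  have hXp : ∀ i : Fin (1 + 2), DifferentiableOn ℂ (fun x : Fin (1 + 2) → ℂ => x i ^ (m + 2)) U := fun i => by
    fun_prop
  have hkinv_d : DifferentiableOn ℂ (fun x => (k x)⁻¹) U := hk_d.inv hk_ne
  have hu_d : DifferentiableOn ℂ u U := (hX 0).add ((hXp 1).mul hkinv_d)
  have hv_d : DifferentiableOn ℂ v U := (hX 1).add ((hXp 0).mul hkinv_d)
  have ha_d : DifferentiableOn ℂ a U := (hk_d.mul hu_d).neg
  have hθ₀_d : DifferentiableOn ℂ θ₀ U :=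
    ((ha_d.add hv_d).mul_const (2 : ℂ)⁻¹).congr fun x _ => by simp only [θ₀, div_eq_mul_inv, Pi.add_apply]
  have hθ₁_d : DifferentiableOn ℂ θ₁ U :=
    ((ha_d.sub hv_d).mul_const (2 * I)⁻¹).congr fun x _ => by simp only [θ₁, div_eq_mul_inv, Pi.sub_apply]
  have hθ_d : DifferentiableOn ℂ θ U := by
    refine differentiableOn_pi.2 fun i => ?_
    fin_cases i
    · exact hθ₀_d
    · exact hθ₁_d
    · exact hX 2
  -- hence analytic and real-smooth on `U`
  have hθ_an : AnalyticOnNhd ℂ θ U := Literature.Analysis.Complex.SCV.analyticOnNhd_of_differentiableOn hθ_d hUo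
  have hθ_cd : ContDiffOn ℂ ω θ U := hθ_an.contDiffOn_of_completeSpace
  have hθ_cdR : ContDiffOn ℝ ∞ θ U := (hθ_cd.restrict_scalars ℝ).of_le le_top
  -- values at `0`
  have hu0 : u 0 = 0 := by simp [u]
  have hv0 : v 0 = 0 := by simp [v]
  have hθ0 : θ 0 = 0 := by
    ext i
    fin_cases i
    · simp [θ, θ₀, a, hu0, hv0]
    · simp [θ, θ₁, a, hu0, hv0]
    · simp [θ]
  -- the derivative at `0`
  let P0 : (Fin (1 + 2) → ℂ) →L[ℂ] ℂ := ContinuousLinearMap.proj 0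
  let P1 : (Fin (1 + 2) → ℂ) →L[ℂ] ℂ := ContinuousLinearMap.proj 1
  let P2 : (Fin (1 + 2) → ℂ) →L[ℂ] ℂ := ContinuousLinearMap.proj 2
  have hk_fd : HasFDerivAt k (fderiv ℂ k 0) 0 :=
    ((hk_d 0 h0U).differentiableAt (hUo.mem_nhds h0U)).hasFDerivAt
  have hkinv_fd : HasFDerivAt (fun x => (k x)⁻¹) (fderiv ℂ (fun x => (k x)⁻¹) 0) 0 :=
    (((hk_d 0 h0U).differentiableAt (hUo.mem_nhds h0U)).inv (by rw [hk0]; exact one_ne_zero)).hasFDerivAt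
  -- `x ↦ xᵢ^{m+2} / k x` has derivative `0` at `0`
  have hpow_fd : ∀ i : Fin (1 + 2), HasFDerivAt (fun x : Fin (1 + 2) → ℂ => x i ^ (m + 2) * (k x)⁻¹)
      (0 : (Fin (1 + 2) → ℂ) →L[ℂ] ℂ) 0 := by
    intro i
    have h1 := (hasFDerivAt_apply (𝕜 := ℂ) i (0 : Fin (1 + 2) → ℂ)).pow (m + 2)
    have h1' : HasFDerivAt (fun x : Fin (1 + 2) → ℂ => x i ^ (m + 2)) (0 : (Fin (1 + 2) → ℂ) →L[ℂ] ℂ) 0 :=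
      h1.congr_fderiv (by ext y; simp)
    have h2 := h1'.mul hkinv_fd
    exact h2.congr_fderiv (by ext y; simp [zero_pow (show m + 2 ≠ 0 by omega)])
  have hu_fd : HasFDerivAt u P0 0 := by
    have h := (hasFDerivAt_apply 0 (0 : Fin (1 + 2) → ℂ)).add (hpow_fd 1)
    rw [add_zero] at h
    exact h
  have hv_fd : HasFDerivAt v P1 0 := by
    have h := (hasFDerivAt_apply 1 (0 : Fin (1 + 2) → ℂ)).add (hpow_fd 0)
    rw [add_zero] at h
    exact h
  have ha_fd : HasFDerivAt a (-P0) 0 := by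
    have h := (hk_fd.mul hu_fd).neg
    exact h.congr_fderiv (by ext y; simp [hk0, hu0, P0])
  have hθ₀_fd : HasFDerivAt θ₀ ((2 : ℂ)⁻¹ • (-P0 + P1)) 0 := by
    have h := (ha_fd.add hv_fd).mul_const ((2 : ℂ)⁻¹)
    refine (h.congr_fderiv ?_).congr_of_eventuallyEq (Filter.Eventually.of_forall fun x => ?_)
    · ext y; simp [smul_eq_mul]
    · simp [θ₀, div_eq_mul_inv]
  have hθ₁_fd : HasFDerivAt θ₁ ((2 * I)⁻¹ • (-P0 - P1)) 0 := by
    have h := (ha_fd.sub hv_fd).mul_const ((2 * I)⁻¹)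
    refine (h.congr_fderiv ?_).congr_of_eventuallyEq (Filter.Eventually.of_forall fun x => ?_)
    · ext y; simp [smul_eq_mul]
    · simp [θ₁, div_eq_mul_inv]
  -- the derivative as a continuous linear equivalence
  let Lfun : (Fin (1 + 2) → ℂ) → (Fin (1 + 2) → ℂ) := fun h => ![(-h 0 + h 1) / 2, (-h 0 - h 1) / (2 * I), h 2]
  let Linv : (Fin (1 + 2) → ℂ) → (Fin (1 + 2) → ℂ) := fun z => ![-(z 0 + I * z 1), z 0 - I * z 1, z 2]
  have hLlin_add : ∀ h h', Lfun (h + h') = Lfun h + Lfun h' := fun h h' => by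
    ext i; fin_cases i <;> simp [Lfun] <;> ring
  have hLlin_smul : ∀ (c : ℂ) h, Lfun (c • h) = c • Lfun h := fun c h => by
    ext i; fin_cases i <;> simp [Lfun] <;> ring
  let Llin : (Fin (1 + 2) → ℂ) →ₗ[ℂ] (Fin (1 + 2) → ℂ) :=
    { toFun := Lfun, map_add' := hLlin_add, map_smul' := hLlin_smul }
  have hLinv₁ : ∀ h, Linv (Lfun h) = h := fun h => by
    ext i; fin_cases i
    · simp [Lfun, Linv]; field_simp; ring_nf
    · simp [Lfun, Linv]; field_simp; ring_nf
    · simp [Lfun, Linv]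
  have hLinv₂ : ∀ z, Lfun (Linv z) = z := fun z => by
    ext i; fin_cases i
    · simp [Lfun, Linv]
    · simp [Lfun, Linv]; field_simp; ring_nf
    · simp [Lfun, Linv]
  let Leq : (Fin (1 + 2) → ℂ) ≃ₗ[ℂ] (Fin (1 + 2) → ℂ) :=
    { Llin with invFun := Linv, left_inv := hLinv₁, right_inv := hLinv₂ }
  let L : (Fin (1 + 2) → ℂ) ≃L[ℂ] (Fin (1 + 2) → ℂ) := Leq.toContinuousLinearEquiv
  have hL_apply : ∀ h, L h = Lfun h := fun h => rfl
  have hθ_fd : HasFDerivAt θ (L : (Fin (1 + 2) → ℂ) →L[ℂ] (Fin (1 + 2) → ℂ)) 0 := by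
    rw [hasFDerivAt_pi']
    intro i
    fin_cases i
    · refine hθ₀_fd.congr_fderiv ?_
      ext h
      simp [hL_apply, Lfun, P0, P1, div_eq_mul_inv]
      ring
    · refine hθ₁_fd.congr_fderiv ?_
      ext h
      simp [hL_apply, Lfun, P0, P1, div_eq_mul_inv]
      ring
    · refine (hasFDerivAt_apply 2 (0 : Fin (1 + 2) → ℂ)).congr_fderiv ?_
      ext h
      simp [hL_apply, Lfun]
  -- the identity `Σ (θ x)ᵢ^{eᵢ} = φ x` on `U`
  have hident : ∀ x ∈ U, ∑ i, (θ x) i ^ cyclicNodeExponents (m + 3) i =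
      x 2 ^ (m + 3) - (x 0 * x 1 + x 0 ^ (m + 3) + x 1 ^ (m + 3)) := by
    intro x hx
    have hsum : ∑ i, (θ x) i ^ cyclicNodeExponents (m + 3) i = θ₀ x ^ 2 + θ₁ x ^ 2 + x 2 ^ (m + 3) := by
      simp [Fin.sum_univ_succ, cyclicNodeExponents, θ, add_assoc]
    rw [hsum]
    have hab : θ₀ x ^ 2 + θ₁ x ^ 2 = a x * v x := half_sum_sq_add_half_diff_sq _ _
    rw [hab]
    have hf := morse_factorisation m (hk_ne x hx) (hk2 x)
    simp only [div_eq_mul_inv] at hf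
    simp only [a, u, v]
    linear_combination (-1 : ℂ) * hf
  -- inverse function theorem at `0`, over `ℝ`
  let LR : (Fin (1 + 2) → ℂ) ≃L[ℝ] (Fin (1 + 2) → ℂ) := L.restrictScalars ℝ
  have hθ_fdR : HasFDerivAt θ (LR : (Fin (1 + 2) → ℂ) →L[ℝ] (Fin (1 + 2) → ℂ)) 0 := hθ_fd.restrictScalars ℝ
  have hθ_cdA : ContDiffAt ℝ ∞ θ 0 := hθ_cdR.contDiffAt (hUo.mem_nhds h0U)
  have htop : (∞ : WithTop ℕ∞) ≠ 0 := by decide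
  -- shrink `U` to where the real derivative is invertible
  let W : Set (Fin (1 + 2) → ℂ) := U ∩ (fderiv ℝ θ) ⁻¹'
    range ((↑) : ((Fin (1 + 2) → ℂ) ≃L[ℝ] (Fin (1 + 2) → ℂ)) → (Fin (1 + 2) → ℂ) →L[ℝ] (Fin (1 + 2) → ℂ))
  have hWo : IsOpen W :=
    (hθ_cdR.continuousOn_fderiv_of_isOpen hUo (by decide)).isOpen_inter_preimage hUo ContinuousLinearEquiv.isOpen
  have h0W : (0 : Fin (1 + 2) → ℂ) ∈ W := ⟨h0U, ⟨LR, hθ_fdR.fderiv.symm⟩⟩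
  let Ψ₀ := hθ_cdA.toOpenPartialHomeomorph θ hθ_fdR htop
  let Ψ := Ψ₀.restrOpen W hWo
  have hΨθ : ∀ z, Ψ z = θ z := fun z => rfl
  have hΨsrc : Ψ.source = Ψ₀.source ∩ W := Ψ₀.restrOpen_source W hWo
  have h0Ψ : (0 : Fin (1 + 2) → ℂ) ∈ Ψ.source := by
    rw [hΨsrc]
    exact ⟨hθ_cdA.mem_toOpenPartialHomeomorph_source hθ_fdR htop, h0W⟩
  have hΨU : Ψ.source ⊆ U := fun z hz => by rw [hΨsrc] at hz; exact hz.2.1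
  have hΨW : Ψ.source ⊆ W := fun z hz => by rw [hΨsrc] at hz; exact hz.2
  have hΨsymm : ContDiffOn ℝ ∞ Ψ.symm Ψ.target := by
    refine Literature.Geometry.Manifold.contDiffOn_symm_of_forall_hasFDerivAt_equiv Ψ (fun z _ => hΨθ z) htop
      (fun z hz => hθ_cdR.contDiffAt (hUo.mem_nhds (hΨU hz))) fun z hz => ?_
    obtain ⟨e, he⟩ := (hΨW hz).2
    refine ⟨e, ?_⟩
    rw [he]
    exact ((hθ_cdR.differentiableOn (by decide) _ (hΨU hz)).differentiableAt (hUo.mem_nhds (hΨU hz))).hasFDerivAt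
  refine ⟨Ψ, h0Ψ, ?_, hθ_d.mono hΨU, hθ_cdR.mono hΨU, hΨsymm, fun x hx => hident x (hΨU hx), fun x _ => rfl⟩
  rw [hΨθ]
  exact hθ0

end MorseChart

end PhamBrieskorn

end Literature.Geometry.ComplexAnalytic

end
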